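import Summits.QuantumFields.YangMills.Theorems.LuscherReductionTwistedTraceScalingBOStiffFlatPoincare
import HarnessLib

/-!
# (B-ST) ★★★ THE FLAT POINCARÉ INEQUALITY, SELF-NORMALISED AND ON LEBESGUE MEASURE — the lead's preferred currency for the `hflat` bridge
# (lane A of S-BASE, crux `TwistedTraceScaling` stmt-QuantumFields-20203, C4-CORE, the (B-ST) pen; hand C `…-w3`; lead g22 INBOX 22:33:49Z «INTERFACE FOR hflat»,
# w2 ✓`…BOStiffPiTransport.hflat_map_of_pullback` / `hflat_transport_cS_map`)

✓`…BOStiffFlatPoincare.flat_poincare` states `hflat` in flat coordinates with the NORMALISED kernel `J_flat = (h₀Kh₀/λ₀) ⊗ (D_ZD_Z'/M_Z)` on `ν = dy|_T ⊗ κ`.  The lead's flat twin of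
`hflat` (INBOX 22:33:49Z) wants the jump kernel normalised by the flat integrals of the SAME measure, `J₀ = 𝟙_{S×S}G·Z/I`, `Z = ∫_S D`, `I = ∫_S∫_S G`, `G = h₀Kh₀' ⊗ D_ZD_Z'` unnormalised
(then every constant — `λ₀`, `M_Z`, `2^{n/2}`, `N̄`, chart Jacobians — cancels and the transport `ν → π` of w2 is by constant-grade density bounds), and all integrals as SET integrals
over `S` against an additive Haar measure of the flat space.  This file supplies exactly that:
* `flat_rowS_bounds`, `flat_massS_bounds` — `(1−ε_R−ε_S)D(p) ≤ ∫_S J_flat(p,·) ≤ D(p)` on `S`, hence `(1−ε_R−ε_S)Z ≤ ∫_S∫_S J_flat ≤ Z` (row floor of ✓`mehlerJ_exit_row`, exit of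
  ✓`product_exit_mass_le`, eigen-equation);
* ★★★ `flat_poincare_selfNormalised` — `ε_R, ε_S ≤ 1/4`: `∫_S g²D − (∫_S gD)²/∫_S D ≤ (2/(1−ρ))·½∫_S∫_S (g(p)−g(q))²·G(p,q)·(Z/I) dν² + (2/(1−ρ))(ε_S+ε_R)·∫_S g²D`
  (`J_flat = G/(λ₀M_Z) ≤ G·Z/I` pointwise since `I = λ₀M_Z·∫_S∫_S J_flat ≤ λ₀M_Z·Z`; the censored double integral of ✓`flat_poincare_betaFree` in set form via R63 ✓`censoredForm_eq`);
* ★★★ `flat_poincare_volume` — the same on plain LEBESGUE measure of `ℝ^σ × ℝ^τ` (gauge window `W' ⊆ ℝ^τ` of finite volume, `S ⊆ [−R,R]^σ × W'`; `(dy|_T ⊗ dz|_{W'})|_S = (dy dz)|_S`):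
  the literal `h` of ✓`hflat_map_of_pullback` for `V = ℝ^σ × ℝ^τ`, `μ = volume`, data `g∘T`, `D∘T = h₀² ⊗ D_Z`, `J₀∘(T×T) = G·Z/I`.
What the bridge `…BOStiffFlatBridge` (lead) still supplies: the linear chart `T : ℝ^σ × ℝ^τ → Bal` (stiff eigenframe of `(β/2)H` on `V_Bal`, Mehler normalisation `ξ_i = y_i√(π/c_i)` so that
`e^{−2q_β} = e^{−2π|y|²} ∝ h₀(y)²`; gauge coordinates with `D_Z = e^{−‖z‖²β²}`), ✓`coreStable_weightedBall` for `T⁻¹(cS)`, and the comparison of `cΘcKcΘ'` with `G∘(T×T)⁻¹`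
(true magnetic factor `e^{−(β/2)S}` vs `e^{−⟨x̂,(β/2)Hx̂⟩}`, a factor `e^{±o(1)}` on `cS`, absorbed in `P₀`).
HONEST FRAMING: classical Dirichlet-form bookkeeping for a stub of a child of the CONDITIONAL route R2b1; (B-ST) OPEN; C4-CORE OPEN; not infinite volume, not a gap, not Clay.

## References
* A. Wipf, *Statistical Approach to Quantum Field Theory*, LNP 992, Springer 2021, §8.5.1 (8.56)–(8.58). [Wipf2021]
* M. Fukushima, Y. Oshima, M. Takeda, *Dirichlet Forms and Symmetric Markov Processes*, de Gruyter 2011, §4.4. [FukushimaOshimaTakeda2011]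
-/

set_option autoImplicit false

noncomputable section

open MeasureTheory Filter
open scoped Real

namespace Summit.QuantumFields.YangMills.Theorems.FemtoTransferGap.Mehler

open Literature.Analysis.SegalBargmann

section SelfNormalised

open StiffDoor Summit.QuantumFields.YangMills.Theorems.TwistedTraceScaling.Negative.R63

variable {σ : Type*} [Fintype σ] [DecidableEq σ]
variable {Z : Type*} [MeasurableSpace Z] {κ : Measure Z} [IsFiniteMeasure κ]

/-- ★ **Rows of the flat kernel inside the support.**  In the setting of `flat_poincare` (window `μ = dy|_T`, `T = [−R,R]^σ`, `S ⊆ T × Z` core-stable at scale `(t,W)`), for every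
`p ∈ S`:  `(1 − ε_R − ε_S)·D(p) ≤ ∫_S J_flat(p,q) dν(q) ≤ D(p)` (`ν = μ ⊗ κ`, `D = h₀² ⊗ D_Z`, `J_flat = (h₀Kh₀/λ₀) ⊗ (D_ZD_Z'/M_Z)`): the upper bound is the eigen-equation
`∫J(y,·) ≤ h₀(y)²`, the lower bound is the row floor of ✓`mehlerJ_exit_row` minus the exit mass of ✓`product_exit_mass_le`. [folklore] -/
theorem flat_rowS_bounds {a b : σ → ℝ} (ha : ∀ k, 0 < a k) (hb : ∀ k, 0 < b k) (hab : ∀ k, a k ^ 2 + 2 * a k * b k = π ^ 2)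
    {ρ : ℝ} (hρ : ∀ k, b k / (a k + b k + π) ≤ ρ) (hρ1 : ρ ≤ 1) {R : ℝ} (hRpos : 0 < R)
    {μ : Measure (σ → ℝ)} (hμT : μ = (volume : Measure (σ → ℝ)).restrict {y : σ → ℝ | ∀ k, |y k - 0| ≤ R})
    {DZ : Z → ℝ} (hDZ : Measurable DZ) {CZ : ℝ} (hDZb : ∀ z, |DZ z| ≤ CZ) (hDZ0 : ∀ z, 0 ≤ DZ z) (hMZ : 0 < ∫ z, DZ z ∂κ)
    {S : Set ((σ → ℝ) × Z)} (hS : MeasurableSet S) (hST : ∀ p ∈ S, ∀ k, |p.1 k - 0| ≤ R)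
    {t : ℝ} (ht : 0 ≤ t) {W : Set Z} (hW : MeasurableSet W)
    (hcore : ∀ p ∈ S, ∀ q : (σ → ℝ) × Z, (∀ k, |q.1 k - b k / (a k + b k + π) * p.1 k| ≤ t) → q.2 ∈ W → q ∈ S)
    {p : (σ → ℝ) × Z} (hp : p ∈ S) :
    (1 - 2 * Fintype.card σ * Real.exp (-(π * ((1 - ρ) * R) ^ 2)) - (2 * Fintype.card σ * Real.exp (-(π * t ^ 2)) + (∫ z in Wᶜ, DZ z ∂κ) / ∫ z, DZ z ∂κ)) *
        (hR 0 p.1 ^ 2 * DZ p.2) ≤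
      ∫ q in S, (hR 0 p.1 * mehlerKernel a b p.1 q.1 * hR 0 q.1 / ∏ k, Real.sqrt (π / (a k + b k + π))) * (DZ p.2 * DZ q.2 / ∫ z, DZ z ∂κ) ∂(μ.prod κ) ∧
    ∫ q in S, (hR 0 p.1 * mehlerKernel a b p.1 q.1 * hR 0 q.1 / ∏ k, Real.sqrt (π / (a k + b k + π))) * (DZ p.2 * DZ q.2 / ∫ z, DZ z ∂κ) ∂(μ.prod κ) ≤
      hR 0 p.1 ^ 2 * DZ p.2 := by
  have hvolT := volume_box (fun _ : σ => (0 : ℝ)) hRpos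
  have hexit := mehlerJ_exit_row ha hb hab hρ hρ1 hRpos.le (hST p hp)
  subst hμT
  set T : Set (σ → ℝ) := {y : σ → ℝ | ∀ k, |y k - 0| ≤ R} with hTdef
  haveI : IsFiniteMeasure ((volume : Measure (σ → ℝ)).restrict T) := isFiniteMeasure_restrict.2 hvolT.1.ne
  obtain ⟨hFm, hF0, -, hFb, -⟩ := flatJ_admissible (Z := Z) ha hb hDZ hDZb hDZ0 hMZ
  have hμle : ((volume : Measure (σ → ℝ)).restrict T) ≤ volume := Measure.restrict_le_self
  -- the full row: `∫ J_flat(p,·) dν = (∫_T J(p₁,·))·D_Z(p₂)`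
  have hFi : Integrable (fun q : (σ → ℝ) × Z =>
      (hR 0 p.1 * mehlerKernel a b p.1 q.1 * hR 0 q.1 / ∏ k, Real.sqrt (π / (a k + b k + π))) * (DZ p.2 * DZ q.2 / ∫ z, DZ z ∂κ))
      ((((volume : Measure (σ → ℝ)).restrict T)).prod κ) :=
    integrable_of_measurable_abs_le _ (hFm.comp (measurable_const.prodMk measurable_id) :) (fun q => hFb p q)
  have hrow : ∫ q, (hR 0 p.1 * mehlerKernel a b p.1 q.1 * hR 0 q.1 / ∏ k, Real.sqrt (π / (a k + b k + π))) * (DZ p.2 * DZ q.2 / ∫ z, DZ z ∂κ)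
      ∂((((volume : Measure (σ → ℝ)).restrict T)).prod κ) =
      (∫ y', hR 0 p.1 * mehlerKernel a b p.1 y' * hR 0 y' / ∏ k, Real.sqrt (π / (a k + b k + π)) ∂((volume : Measure (σ → ℝ)).restrict T)) * DZ p.2 := by
    rw [integral_prod_mul (μ := ((volume : Measure (σ → ℝ)).restrict T)) (ν := κ)
      (fun y' => hR 0 p.1 * mehlerKernel a b p.1 y' * hR 0 y' / ∏ k, Real.sqrt (π / (a k + b k + π))) (fun z' => DZ p.2 * DZ z' / ∫ z, DZ z ∂κ)]
    congr 1
    have e : (fun z' => DZ p.2 * DZ z' / ∫ z, DZ z ∂κ) = fun z' => (DZ p.2 / ∫ z, DZ z ∂κ) * DZ z' := funext fun z' => by ring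
    rw [e, integral_const_mul, div_mul_cancel₀ _ hMZ.ne']
  -- upper bound
  have hup : ∫ q in S, (hR 0 p.1 * mehlerKernel a b p.1 q.1 * hR 0 q.1 / ∏ k, Real.sqrt (π / (a k + b k + π))) * (DZ p.2 * DZ q.2 / ∫ z, DZ z ∂κ)
      ∂((((volume : Measure (σ → ℝ)).restrict T)).prod κ) ≤ hR 0 p.1 ^ 2 * DZ p.2 := by
    refine (setIntegral_le_integral hFi (ae_of_all _ fun q => hF0 p q)).trans ?_
    rw [hrow]
    exact mul_le_mul_of_nonneg_right (integral_mehlerJ_window_le ha hb hab hμle p.1) (hDZ0 _)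
  refine ⟨?_, hup⟩
  -- lower bound: full row minus exit
  have hsplit := integral_add_compl hS hFi
  have hκS := product_exit_mass_le (μ := (volume : Measure (σ → ℝ)).restrict T) ha hb hab hμle hDZ hDZb hDZ0 hMZ hS ht hW hcore hp
  have hfloor : (1 - 2 * Fintype.card σ * Real.exp (-(π * ((1 - ρ) * R) ^ 2))) * (hR 0 p.1 ^ 2 * DZ p.2) ≤
      (∫ y', hR 0 p.1 * mehlerKernel a b p.1 y' * hR 0 y' / ∏ k, Real.sqrt (π / (a k + b k + π)) ∂((volume : Measure (σ → ℝ)).restrict T)) * DZ p.2 := by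
    rw [← mul_assoc]; exact mul_le_mul_of_nonneg_right hexit.2 (hDZ0 _)
  rw [hrow] at hsplit
  nlinarith [hsplit, hκS, hfloor]

/-- ★ **Mass of the censored flat kernel**: `(1 − ε_R − ε_S)·∫_S D ≤ ∫_S∫_S J_flat dν² ≤ ∫_S D`. [folklore] -/
theorem flat_massS_bounds {a b : σ → ℝ} (ha : ∀ k, 0 < a k) (hb : ∀ k, 0 < b k) (hab : ∀ k, a k ^ 2 + 2 * a k * b k = π ^ 2)
    {ρ : ℝ} (hρ : ∀ k, b k / (a k + b k + π) ≤ ρ) (hρ1 : ρ ≤ 1) {R : ℝ} (hRpos : 0 < R)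
    {μ : Measure (σ → ℝ)} (hμT : μ = (volume : Measure (σ → ℝ)).restrict {y : σ → ℝ | ∀ k, |y k - 0| ≤ R})
    {DZ : Z → ℝ} (hDZ : Measurable DZ) {CZ : ℝ} (hDZb : ∀ z, |DZ z| ≤ CZ) (hDZ0 : ∀ z, 0 ≤ DZ z) (hMZ : 0 < ∫ z, DZ z ∂κ)
    {S : Set ((σ → ℝ) × Z)} (hS : MeasurableSet S) (hST : ∀ p ∈ S, ∀ k, |p.1 k - 0| ≤ R)
    {t : ℝ} (ht : 0 ≤ t) {W : Set Z} (hW : MeasurableSet W)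
    (hcore : ∀ p ∈ S, ∀ q : (σ → ℝ) × Z, (∀ k, |q.1 k - b k / (a k + b k + π) * p.1 k| ≤ t) → q.2 ∈ W → q ∈ S) :
    (1 - 2 * Fintype.card σ * Real.exp (-(π * ((1 - ρ) * R) ^ 2)) - (2 * Fintype.card σ * Real.exp (-(π * t ^ 2)) + (∫ z in Wᶜ, DZ z ∂κ) / ∫ z, DZ z ∂κ)) *
        ∫ p in S, hR 0 p.1 ^ 2 * DZ p.2 ∂(μ.prod κ) ≤
      ∫ p in S, ∫ q in S, (hR 0 p.1 * mehlerKernel a b p.1 q.1 * hR 0 q.1 / ∏ k, Real.sqrt (π / (a k + b k + π))) * (DZ p.2 * DZ q.2 / ∫ z, DZ z ∂κ)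
        ∂(μ.prod κ) ∂(μ.prod κ) ∧
    ∫ p in S, ∫ q in S, (hR 0 p.1 * mehlerKernel a b p.1 q.1 * hR 0 q.1 / ∏ k, Real.sqrt (π / (a k + b k + π))) * (DZ p.2 * DZ q.2 / ∫ z, DZ z ∂κ)
        ∂(μ.prod κ) ∂(μ.prod κ) ≤ ∫ p in S, hR 0 p.1 ^ 2 * DZ p.2 ∂(μ.prod κ) := by
  have hrows := fun (p : (σ → ℝ) × Z) (hp : p ∈ S) => flat_rowS_bounds (κ := κ) ha hb hab hρ hρ1 hRpos hμT hDZ hDZb hDZ0 hMZ hS hST ht hW hcore hp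
  have hvolT := volume_box (fun _ : σ => (0 : ℝ)) hRpos
  subst hμT
  haveI : IsFiniteMeasure ((volume : Measure (σ → ℝ)).restrict {y : σ → ℝ | ∀ k, |y k - 0| ≤ R}) := isFiniteMeasure_restrict.2 hvolT.1.ne
  obtain ⟨hFm, -, -, hFb, hDDm, -, hDDb⟩ := flatJ_admissible (Z := Z) ha hb hDZ hDZb hDZ0 hMZ
  -- integrability of the row function and of `D` on `ν|_S`
  obtain ⟨hRm, hRb⟩ := measurable_integral_right_of_bdd
    (μ := ((((volume : Measure (σ → ℝ)).restrict {y : σ → ℝ | ∀ k, |y k - 0| ≤ R})).prod κ).restrict S) hFm hFb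
  have iR : Integrable (fun p : (σ → ℝ) × Z => ∫ q in S, (hR 0 p.1 * mehlerKernel a b p.1 q.1 * hR 0 q.1 / ∏ k, Real.sqrt (π / (a k + b k + π))) *
      (DZ p.2 * DZ q.2 / ∫ z, DZ z ∂κ) ∂((((volume : Measure (σ → ℝ)).restrict {y : σ → ℝ | ∀ k, |y k - 0| ≤ R})).prod κ))
      (((((volume : Measure (σ → ℝ)).restrict {y : σ → ℝ | ∀ k, |y k - 0| ≤ R})).prod κ).restrict S) :=
    integrable_of_measurable_abs_le _ hRm hRb
  have iD : Integrable (fun p : (σ → ℝ) × Z => hR 0 p.1 ^ 2 * DZ p.2) (((((volume : Measure (σ → ℝ)).restrict {y : σ → ℝ | ∀ k, |y k - 0| ≤ R})).prod κ).restrict S) :=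
    integrable_of_measurable_abs_le _ hDDm hDDb
  constructor
  · rw [← integral_const_mul]
    exact setIntegral_mono_on (iD.const_mul _) iR hS fun p hp => (hrows p hp).1
  · exact setIntegral_mono_on iR iD hS fun p hp => (hrows p hp).2
set_option maxHeartbeats 400000 in
/-- ★★★ **THE FLAT POINCARÉ INEQUALITY, SELF-NORMALISED** (the lead's preferred currency, HANDOFF-g22 / INBOX 22:33:49Z: the jump kernel normalised by the flat integrals `Z/I` of the
SAME measure, so that every constant — `λ₀`, `M_Z`, `2^{n/2}`, `N̄`, the chart Jacobian — cancels).  Setting of `flat_poincare` with `ε_R, ε_S ≤ 1/4`; `G(p,q) = h₀(p₁)K(p₁,q₁)h₀(q₁)·D_Z(p₂)D_Z(q₂)`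
the UNNORMALISED Gaussian kernel, `Z = ∫_S D dν`, `I = ∫_S∫_S G dν²`.  For every bounded measurable `g` vanishing off `S`:
`∫_S g²D − (∫_S gD)²/∫_S D ≤ (2/(1−ρ))·½∫_S∫_S (g(p)−g(q))²·G(p,q)·(Z/I) dν dν + (2/(1−ρ))(ε_S+ε_R)·∫_S g²D`
(from ✓`flat_poincare_betaFree`: the normalised kernel `J_flat = G/(λ₀M_Z)` is `≤ G·Z/I` pointwise because `I/(λ₀M_Z) = ∫_S∫_S J_flat ≤ Z`, `flat_massS_bounds`). [cite: Wipf2021, §8.5.1 (8.58)] -/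
theorem flat_poincare_selfNormalised {a b : σ → ℝ} (ha : ∀ k, 0 < a k) (hb : ∀ k, 0 < b k) (hab : ∀ k, a k ^ 2 + 2 * a k * b k = π ^ 2)
    {ρ : ℝ} (hρ0 : 0 ≤ ρ) (hρ : ∀ k, b k / (a k + b k + π) ≤ ρ) (hρ1 : ρ < 1) {R : ℝ} (hRpos : 0 < R)
    (hεR : 2 * Fintype.card σ * Real.exp (-(π * ((1 - ρ) * R) ^ 2)) ≤ 1 / 4)
    {μ : Measure (σ → ℝ)} (hμT : μ = (volume : Measure (σ → ℝ)).restrict {y : σ → ℝ | ∀ k, |y k - 0| ≤ R})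
    {DZ : Z → ℝ} (hDZ : Measurable DZ) {CZ : ℝ} (hDZb : ∀ z, |DZ z| ≤ CZ) (hDZ0 : ∀ z, 0 ≤ DZ z) (hMZ : 0 < ∫ z, DZ z ∂κ)
    {S : Set ((σ → ℝ) × Z)} (hS : MeasurableSet S) (hST : ∀ p ∈ S, ∀ k, |p.1 k - 0| ≤ R)
    {t : ℝ} (ht : 0 ≤ t) {W : Set Z} (hW : MeasurableSet W)
    (hcore : ∀ p ∈ S, ∀ q : (σ → ℝ) × Z, (∀ k, |q.1 k - b k / (a k + b k + π) * p.1 k| ≤ t) → q.2 ∈ W → q ∈ S)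
    (hεS : 2 * Fintype.card σ * Real.exp (-(π * t ^ 2)) + (∫ z in Wᶜ, DZ z ∂κ) / ∫ z, DZ z ∂κ ≤ 1 / 4)
    (hZS : 0 < ∫ p in S, hR 0 p.1 ^ 2 * DZ p.2 ∂(μ.prod κ))
    {g : (σ → ℝ) × Z → ℝ} (hg : Measurable g) {Cg : ℝ} (hgb : ∀ p, |g p| ≤ Cg) (hgS : ∀ p, p ∉ S → g p = 0) :
    (∫ p in S, g p ^ 2 * (hR 0 p.1 ^ 2 * DZ p.2) ∂(μ.prod κ)) - (∫ p in S, g p * (hR 0 p.1 ^ 2 * DZ p.2) ∂(μ.prod κ)) ^ 2 /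
        (∫ p in S, hR 0 p.1 ^ 2 * DZ p.2 ∂(μ.prod κ)) ≤
      2 / (1 - ρ) * ((1 / 2) * ∫ p in S, ∫ q in S, (g p - g q) ^ 2 *
          (hR 0 p.1 * mehlerKernel a b p.1 q.1 * hR 0 q.1 * (DZ p.2 * DZ q.2) *
            ((∫ p in S, hR 0 p.1 ^ 2 * DZ p.2 ∂(μ.prod κ)) /
              ∫ p in S, ∫ q in S, hR 0 p.1 * mehlerKernel a b p.1 q.1 * hR 0 q.1 * (DZ p.2 * DZ q.2) ∂(μ.prod κ) ∂(μ.prod κ))) ∂(μ.prod κ) ∂(μ.prod κ)) +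
        2 / (1 - ρ) * ((2 * Fintype.card σ * Real.exp (-(π * t ^ 2)) + (∫ z in Wᶜ, DZ z ∂κ) / ∫ z, DZ z ∂κ) +
            2 * Fintype.card σ * Real.exp (-(π * ((1 - ρ) * R) ^ 2))) *
          ∫ p in S, g p ^ 2 * (hR 0 p.1 ^ 2 * DZ p.2) ∂(μ.prod κ) := by
  have h := flat_poincare_betaFree (κ := κ) ha hb hab hρ0 hρ hρ1 hRpos (hεR.trans (by norm_num)) hμT hDZ hDZb hDZ0 hMZ hS hST ht hW hcore hZS hg hgb hgS
  obtain ⟨hmlo, hmup⟩ := flat_massS_bounds (κ := κ) ha hb hab hρ hρ1.le hRpos hμT hDZ hDZb hDZ0 hMZ hS hST ht hW hcore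
  obtain ⟨hFm, hF0, -, hFb, -⟩ := flatJ_admissible (Z := Z) ha hb hDZ hDZb hDZ0 hMZ
  obtain ⟨-, -, hin, hout⟩ := flatJ0_admissible (Z := Z) ha hb hDZ hDZb hDZ0 hMZ hS
  have hvolT := volume_box (fun _ : σ => (0 : ℝ)) hRpos
  subst hμT
  haveI : IsFiniteMeasure ((volume : Measure (σ → ℝ)).restrict {y : σ → ℝ | ∀ k, |y k - 0| ≤ R}) := isFiniteMeasure_restrict.2 hvolT.1.ne
  set ν : Measure ((σ → ℝ) × Z) := (((volume : Measure (σ → ℝ)).restrict {y : σ → ℝ | ∀ k, |y k - 0| ≤ R})).prod κ with hνdef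
  have hL0 := lambda0_pos ha hb
  have h1ρ : 0 < 1 - ρ := by linarith
  -- abbreviate the masses
  set ZS : ℝ := ∫ p in S, hR 0 p.1 ^ 2 * DZ p.2 ∂ν with hZSdef
  set I0 : ℝ := ∫ p in S, ∫ q in S, (hR 0 p.1 * mehlerKernel a b p.1 q.1 * hR 0 q.1 / ∏ k, Real.sqrt (π / (a k + b k + π))) * (DZ p.2 * DZ q.2 / ∫ z, DZ z ∂κ) ∂ν ∂ν
    with hI0def
  -- `I = λ₀ M_Z · I0`
  have eG : ∀ p q : (σ → ℝ) × Z, hR 0 p.1 * mehlerKernel a b p.1 q.1 * hR 0 q.1 * (DZ p.2 * DZ q.2) =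
      ((∏ k, Real.sqrt (π / (a k + b k + π))) * ∫ z, DZ z ∂κ) *
        ((hR 0 p.1 * mehlerKernel a b p.1 q.1 * hR 0 q.1 / ∏ k, Real.sqrt (π / (a k + b k + π))) * (DZ p.2 * DZ q.2 / ∫ z, DZ z ∂κ)) := fun p q => by
    field_simp
  have eI : ∫ p in S, ∫ q in S, hR 0 p.1 * mehlerKernel a b p.1 q.1 * hR 0 q.1 * (DZ p.2 * DZ q.2) ∂ν ∂ν = ((∏ k, Real.sqrt (π / (a k + b k + π))) * ∫ z, DZ z ∂κ) * I0 := by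
    rw [hI0def, ← integral_const_mul]
    refine integral_congr_ae (ae_of_all _ fun p => ?_)
    dsimp only
    rw [← integral_const_mul]
    exact integral_congr_ae (ae_of_all _ fun q => eG p q)
  -- `I0 > 0` and `I0 ≤ Z`
  have hI0pos : 0 < I0 := by
    have hc : (1 : ℝ) / 2 ≤ 1 - 2 * Fintype.card σ * Real.exp (-(π * ((1 - ρ) * R) ^ 2)) -
        (2 * Fintype.card σ * Real.exp (-(π * t ^ 2)) + (∫ z in Wᶜ, DZ z ∂κ) / ∫ z, DZ z ∂κ) := by linarith
    have h1 : (1 : ℝ) / 2 * ZS ≤ I0 := le_trans (mul_le_mul_of_nonneg_right hc hZS.le) hmlo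
    linarith [mul_pos (by norm_num : (0 : ℝ) < 1 / 2) hZS]
  -- the pointwise kernel comparison `J_flat ≤ G·Z/I`
  have hcmp : ∀ p q : (σ → ℝ) × Z,
      (hR 0 p.1 * mehlerKernel a b p.1 q.1 * hR 0 q.1 / ∏ k, Real.sqrt (π / (a k + b k + π))) * (DZ p.2 * DZ q.2 / ∫ z, DZ z ∂κ) ≤
        hR 0 p.1 * mehlerKernel a b p.1 q.1 * hR 0 q.1 * (DZ p.2 * DZ q.2) *
          (ZS / ∫ p in S, ∫ q in S, hR 0 p.1 * mehlerKernel a b p.1 q.1 * hR 0 q.1 * (DZ p.2 * DZ q.2) ∂ν ∂ν) := fun p q => by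
    rw [eI, eG p q]
    have hG0 : 0 ≤ (hR 0 p.1 * mehlerKernel a b p.1 q.1 * hR 0 q.1 / ∏ k, Real.sqrt (π / (a k + b k + π))) * (DZ p.2 * DZ q.2 / ∫ z, DZ z ∂κ) := hF0 p q
    have hLM : 0 < (∏ k, Real.sqrt (π / (a k + b k + π))) * ∫ z, DZ z ∂κ := mul_pos hL0 hMZ
    -- `F ≤ (c·F)·(Z/(c·I0))` iff `I0 ≤ Z`
    have e1 : (∏ k, Real.sqrt (π / (a k + b k + π))) * (∫ z, DZ z ∂κ) *
          ((hR 0 p.1 * mehlerKernel a b p.1 q.1 * hR 0 q.1 / ∏ k, Real.sqrt (π / (a k + b k + π))) * (DZ p.2 * DZ q.2 / ∫ z, DZ z ∂κ)) *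
          (ZS / ((∏ k, Real.sqrt (π / (a k + b k + π))) * (∫ z, DZ z ∂κ) * I0)) =
        ((hR 0 p.1 * mehlerKernel a b p.1 q.1 * hR 0 q.1 / ∏ k, Real.sqrt (π / (a k + b k + π))) * (DZ p.2 * DZ q.2 / ∫ z, DZ z ∂κ)) * (ZS / I0) := by
      field_simp
    rw [e1]
    have h2 : 1 ≤ ZS / I0 := by rw [le_div_iff₀ hI0pos, one_mul]; exact hmup
    nlinarith
  -- monotonicity of the censored jump form in the kernel
  haveI : IsFiniteMeasure (ν.restrict S) := inferInstance
  have hGm : Measurable (Function.uncurry fun p q : (σ → ℝ) × Z => hR 0 p.1 * mehlerKernel a b p.1 q.1 * hR 0 q.1 * (DZ p.2 * DZ q.2) *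
      (ZS / ∫ p in S, ∫ q in S, hR 0 p.1 * mehlerKernel a b p.1 q.1 * hR 0 q.1 * (DZ p.2 * DZ q.2) ∂ν ∂ν)) := by
    have e : (Function.uncurry fun p q : (σ → ℝ) × Z => hR 0 p.1 * mehlerKernel a b p.1 q.1 * hR 0 q.1 * (DZ p.2 * DZ q.2) *
        (ZS / ∫ p in S, ∫ q in S, hR 0 p.1 * mehlerKernel a b p.1 q.1 * hR 0 q.1 * (DZ p.2 * DZ q.2) ∂ν ∂ν)) =
        fun pq => (((∏ k, Real.sqrt (π / (a k + b k + π))) * ∫ z, DZ z ∂κ) *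
          (ZS / ∫ p in S, ∫ q in S, hR 0 p.1 * mehlerKernel a b p.1 q.1 * hR 0 q.1 * (DZ p.2 * DZ q.2) ∂ν ∂ν)) *
          (Function.uncurry (fun p q : (σ → ℝ) × Z =>
            (hR 0 p.1 * mehlerKernel a b p.1 q.1 * hR 0 q.1 / ∏ k, Real.sqrt (π / (a k + b k + π))) * (DZ p.2 * DZ q.2 / ∫ z, DZ z ∂κ)) pq) := by
      funext pq
      change hR 0 pq.1.1 * mehlerKernel a b pq.1.1 pq.2.1 * hR 0 pq.2.1 * (DZ pq.1.2 * DZ pq.2.2) * _ = _ * ((hR 0 pq.1.1 * mehlerKernel a b pq.1.1 pq.2.1 * hR 0 pq.2.1 / ∏ k, Real.sqrt (π / (a k + b k + π))) * (DZ pq.1.2 * DZ pq.2.2 / ∫ z, DZ z ∂κ))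
      rw [eG pq.1 pq.2]; ring
    rw [e]
    exact hFm.const_mul _
  have hE : ∫ p in S, ∫ q in S, (g p - g q) ^ 2 *
        ((hR 0 p.1 * mehlerKernel a b p.1 q.1 * hR 0 q.1 / ∏ k, Real.sqrt (π / (a k + b k + π))) * (DZ p.2 * DZ q.2 / ∫ z, DZ z ∂κ)) ∂ν ∂ν ≤
      ∫ p in S, ∫ q in S, (g p - g q) ^ 2 *
        (hR 0 p.1 * mehlerKernel a b p.1 q.1 * hR 0 q.1 * (DZ p.2 * DZ q.2) *
          (ZS / ∫ p in S, ∫ q in S, hR 0 p.1 * mehlerKernel a b p.1 q.1 * hR 0 q.1 * (DZ p.2 * DZ q.2) ∂ν ∂ν)) ∂ν ∂ν := by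
    obtain ⟨m1, b1⟩ := jumpIntegrand_bdd hFm hFb hg hgb
    have hGb : ∀ p q : (σ → ℝ) × Z, |hR 0 p.1 * mehlerKernel a b p.1 q.1 * hR 0 q.1 * (DZ p.2 * DZ q.2) *
        (ZS / ∫ p in S, ∫ q in S, hR 0 p.1 * mehlerKernel a b p.1 q.1 * hR 0 q.1 * (DZ p.2 * DZ q.2) ∂ν ∂ν)| ≤
        |((∏ k, Real.sqrt (π / (a k + b k + π))) * ∫ z, DZ z ∂κ) * (ZS / ∫ p in S, ∫ q in S, hR 0 p.1 * mehlerKernel a b p.1 q.1 * hR 0 q.1 * (DZ p.2 * DZ q.2) ∂ν ∂ν)| *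
          ((vacCoef σ ^ 2 / ∏ k, Real.sqrt (π / (a k + b k + π))) * (CZ * CZ / ∫ z, DZ z ∂κ)) := fun p q => by
      rw [eG p q, mul_assoc, mul_comm ((hR 0 p.1 * mehlerKernel a b p.1 q.1 * hR 0 q.1 / ∏ k, Real.sqrt (π / (a k + b k + π))) *
        (DZ p.2 * DZ q.2 / ∫ z, DZ z ∂κ)), ← mul_assoc, abs_mul]
      exact mul_le_mul_of_nonneg_left (hFb p q) (abs_nonneg _)
    obtain ⟨m2, b2⟩ := jumpIntegrand_bdd hGm hGb hg hgb
    obtain ⟨r1m, r1b⟩ := measurable_integral_right_of_bdd (μ := ν.restrict S) m1 b1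
    obtain ⟨r2m, r2b⟩ := measurable_integral_right_of_bdd (μ := ν.restrict S) m2 b2
    refine integral_mono (integrable_of_measurable_abs_le _ r1m r1b) (integrable_of_measurable_abs_le _ r2m r2b) fun p => ?_
    refine integral_mono (integrable_of_measurable_abs_le _ (m1.comp (measurable_const.prodMk measurable_id) :) (fun q => b1 p q))
      (integrable_of_measurable_abs_le _ (m2.comp (measurable_const.prodMk measurable_id) :) (fun q => b2 p q)) fun q => ?_
    exact mul_le_mul_of_nonneg_left (hcmp p q) (sq_nonneg _)
  -- the censored double integral of `h` equals the set form
  rw [censoredForm_eq (μ := ν) hin hout hS] at h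
  have hP : 0 ≤ 2 / (1 - ρ) := div_nonneg (by norm_num) h1ρ.le
  have hmono := mul_le_mul_of_nonneg_left (mul_le_mul_of_nonneg_left hE (by norm_num : (0 : ℝ) ≤ 1 / 2)) hP
  linarith [h, hmono]

end SelfNormalised

/-! ## ★★★ On plain Lebesgue measure of `ℝ^σ × ℝ^τ` (the `h` of ✓`…BOStiffPiTransport.hflat_map_of_pullback` with `V = ℝ^σ × ℝ^τ`, `μ = volume`) -/

section Volume

variable {σ τ : Type*} [Fintype σ] [DecidableEq σ] [Fintype τ]

/-- ★★★ **THE SELF-NORMALISED FLAT POINCARÉ INEQUALITY ON LEBESGUE MEASURE.**  Gauge factor `Z = ℝ^τ` with a window `W'` of finite volume carrying `D_Z`, support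
`S ⊆ [−R,R]^σ × W'`; all five integrals are SET integrals over `S` against `volume` on `ℝ^σ × ℝ^τ` (an additive Haar measure), the jump kernel is the unnormalised Gaussian
`G = h₀Kh₀' ⊗ D_ZD_Z'` times `Z/I` of the same measure — exactly the shape pulled back by ✓`hflat_map_of_pullback` (`V = ℝ^σ × ℝ^τ`).  Constants: `P₀ = 2/(1−ρ)`,
`δ = P₀·(ε_S + ε_R)`, `ε_R = 2n·e^{−π(1−ρ)²R²} ≤ 1/4`, `ε_S = 2n·e^{−πt²} + (∫_{Wᶜ∩W'}D_Z)/(∫_{W'}D_Z) ≤ 1/4`. [cite: Wipf2021, §8.5.1 (8.58)] [cite: FukushimaOshimaTakeda2011, §4.4] -/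
theorem flat_poincare_volume {a b : σ → ℝ} (ha : ∀ k, 0 < a k) (hb : ∀ k, 0 < b k) (hab : ∀ k, a k ^ 2 + 2 * a k * b k = π ^ 2)
    {ρ : ℝ} (hρ0 : 0 ≤ ρ) (hρ : ∀ k, b k / (a k + b k + π) ≤ ρ) (hρ1 : ρ < 1) {R : ℝ} (hRpos : 0 < R)
    (hεR : 2 * Fintype.card σ * Real.exp (-(π * ((1 - ρ) * R) ^ 2)) ≤ 1 / 4)
    {W' : Set (τ → ℝ)} (hW'fin : volume W' < ⊤)
    {DZ : (τ → ℝ) → ℝ} (hDZ : Measurable DZ) {CZ : ℝ} (hDZb : ∀ z, |DZ z| ≤ CZ) (hDZ0 : ∀ z, 0 ≤ DZ z) (hMZ : 0 < ∫ z in W', DZ z)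
    {S : Set ((σ → ℝ) × (τ → ℝ))} (hS : MeasurableSet S) (hSTW : S ⊆ {y : σ → ℝ | ∀ k, |y k - 0| ≤ R} ×ˢ W')
    {t : ℝ} (ht : 0 ≤ t) {W : Set (τ → ℝ)} (hW : MeasurableSet W)
    (hcore : ∀ p ∈ S, ∀ q : (σ → ℝ) × (τ → ℝ), (∀ k, |q.1 k - b k / (a k + b k + π) * p.1 k| ≤ t) → q.2 ∈ W → q ∈ S)
    (hεS : 2 * Fintype.card σ * Real.exp (-(π * t ^ 2)) + (∫ z in Wᶜ ∩ W', DZ z) / (∫ z in W', DZ z) ≤ 1 / 4)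
    (hZS : 0 < ∫ p in S, hR 0 p.1 ^ 2 * DZ p.2)
    {g : (σ → ℝ) × (τ → ℝ) → ℝ} (hg : Measurable g) {Cg : ℝ} (hgb : ∀ p, |g p| ≤ Cg) (hgS : ∀ p, p ∉ S → g p = 0) :
    (∫ p in S, g p ^ 2 * (hR 0 p.1 ^ 2 * DZ p.2)) - (∫ p in S, g p * (hR 0 p.1 ^ 2 * DZ p.2)) ^ 2 / (∫ p in S, hR 0 p.1 ^ 2 * DZ p.2) ≤
      2 / (1 - ρ) * ((1 / 2) * ∫ p in S, ∫ q in S, (g p - g q) ^ 2 *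
          (hR 0 p.1 * mehlerKernel a b p.1 q.1 * hR 0 q.1 * (DZ p.2 * DZ q.2) *
            ((∫ p in S, hR 0 p.1 ^ 2 * DZ p.2) / ∫ p in S, ∫ q in S, hR 0 p.1 * mehlerKernel a b p.1 q.1 * hR 0 q.1 * (DZ p.2 * DZ q.2)))) +
        2 / (1 - ρ) * ((2 * Fintype.card σ * Real.exp (-(π * t ^ 2)) + (∫ z in Wᶜ ∩ W', DZ z) / ∫ z in W', DZ z) +
            2 * Fintype.card σ * Real.exp (-(π * ((1 - ρ) * R) ^ 2))) *
          ∫ p in S, g p ^ 2 * (hR 0 p.1 ^ 2 * DZ p.2) := by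
  haveI : IsFiniteMeasure ((volume : Measure (τ → ℝ)).restrict W') := isFiniteMeasure_restrict.2 hW'fin.ne
  -- the two measure identities
  have hν : (((volume : Measure (σ → ℝ)).restrict {y : σ → ℝ | ∀ k, |y k - 0| ≤ R}).prod ((volume : Measure (τ → ℝ)).restrict W')).restrict S =
      (volume : Measure ((σ → ℝ) × (τ → ℝ))).restrict S := by
    rw [Measure.prod_restrict, ← Measure.volume_eq_prod, Measure.restrict_restrict_of_subset hSTW]
  have hWW : ((volume : Measure (τ → ℝ)).restrict W').restrict Wᶜ = (volume : Measure (τ → ℝ)).restrict (Wᶜ ∩ W') := Measure.restrict_restrict hW.compl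
  have hST : ∀ p ∈ S, ∀ k, |p.1 k - 0| ≤ R := fun p hp => (hSTW hp).1
  have hMZ' : 0 < ∫ z, DZ z ∂((volume : Measure (τ → ℝ)).restrict W') := hMZ
  have hεS' : 2 * Fintype.card σ * Real.exp (-(π * t ^ 2)) +
      (∫ z in Wᶜ, DZ z ∂((volume : Measure (τ → ℝ)).restrict W')) / ∫ z, DZ z ∂((volume : Measure (τ → ℝ)).restrict W') ≤ 1 / 4 := by
    rw [hWW]; exact hεS
  have hZS' : 0 < ∫ p in S, hR 0 p.1 ^ 2 * DZ p.2
      ∂(((volume : Measure (σ → ℝ)).restrict {y : σ → ℝ | ∀ k, |y k - 0| ≤ R}).prod ((volume : Measure (τ → ℝ)).restrict W')) := by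
    rw [hν]; exact hZS
  have h := flat_poincare_selfNormalised (κ := (volume : Measure (τ → ℝ)).restrict W') ha hb hab hρ0 hρ hρ1 hRpos hεR rfl hDZ hDZb hDZ0 hMZ' hS hST ht hW
    hcore hεS' hZS' hg hgb hgS
  rw [hν, hWW] at h
  exact h

end Volume

end Summit.QuantumFields.YangMills.Theorems.FemtoTransferGap.Mehler

end
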